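import Literature.NumberTheory.Automorphic.ShimuraCurveRibetTakahashi
import Literature.NumberTheory.Automorphic.ShimuraCurveUnitGroupTraces
import Literature.NumberTheory.Automorphic.ShimuraCurveFiniteVolume
import Literature.NumberTheory.Automorphic.HypFundamentalDomainVolume
import Literature.NumberTheory.Automorphic.BrandtModuleChains
import Literature.NumberTheory.EllipticCurves.ModularDegreeFormulaDomainProofs
import Literature.Analysis.Complex.DiscSubMeanValue
import HarnessLib

/-!
# Pasten 2024, Thm. 8.1 over `ℚ`: the norm comparison `‖h‖_∞ ≤ ν ‖h‖₂` on `X₀^D(M)`, `D > 1`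
# — the analytic theorem, and the discharge `PastenShimura2024_thm_8_1_holds`

Topic `NumberTheory/Automorphic`; a proofs-only companion (theorems only: no definitions, no named
facts) of `ShimuraCurveRibetTakahashi.lean`, for its named fact
`Literature.NumberTheory.Automorphic.PastenShimura2024_thm_8_1` (H. Pasten, *Shimura curves and
the abc conjecture*, J. Number Theory 254 (2024) = arXiv:1705.09251, Thm. 8.1 p. 29, case
`F = ℚ`, `U = U₀^D(M)`): there is an absolute `ν > 0` such that for every Shimura curve datum `X` of
level `(D, M)`, `D > 1`, whose group `Γ = Γ₀^D(M)` acts on `ℍ` without fixed points except for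
`±1`, and every `h ∈ S₂(Γ)`: `sup_z |h(z)| Im z ≤ ν (∫_{X.fd} |h|² (Im z)² dμ)^{1/2}`.

## The printed proof (Pasten §8.2–8.3, pp. 29–30) and this file

* **Injectivity radius** (Lemmas 8.2–8.3). Over `ℚ` this is the tree's
  `ShimuraCurveData.seven_le_two_mul_cosh_dist_smul` (`ShimuraCurveUnitGroupTraces.lean`): every
  `γ ≠ ±1` of `Γ` has integral trace of absolute value `≥ 3` (no elliptic elements by freeness, no
  parabolic ones because `B` is a division algebra for `D > 1`), so `2 cosh d(z, γz) ≥ 7`.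
* **Sub-mean-value inequality** (Lemmas 8.4–8.5). Pasten maps the hyperbolic ball `B_ℍ(τ, r)` to
  the disc by the isometry `c_τ` and uses `π t² |h(0)|² ≤ ∫_{B(0,t)} |h|²`. We use the SAME
  Lemma 8.4 (the tree's `Literature.Analysis.Complex.pi_mul_sq_mul_enorm_sq_le_lintegral_ball`)
  directly on the Euclidean disc `B(τ, Im τ/2) ⊆ ℍ`, on which `|h|² (Im z)² dμ = |h|² dx dy`
  (tree `lintegral_domain_eq_lintegral_image`): `(π/4) |h(τ)|² (Im τ)² ≤ ∫_{B(τ, Im τ/2)} |h|² Im² dμ`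
  (`pi_div_four_mul_le_setLIntegral_ball`). Only the constant differs from (8.5).
* **Proof of the theorem** (p. 30: "This choice of `r` together with Lemma 8.3 ensure
  `∫_{B_ℍ(τ,r)} |h|² y² dμ ≤ ‖h‖²₂`"). Two points of `B(τ, Im τ/2)` are at hyperbolic distance
  `< arccosh 3`, so by the injectivity radius no `γ ≠ ±1` maps a point of the disc into the disc;
  hence the disc packs into any fundamental domain: `∫_{B} G dμ ≤ ∫_{X.fd} G dμ` for the
  `Γ`-invariant `G = |h|² Im²` (`setLIntegral_le_setLIntegral_fd_of_injective`: cover `B` by the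
  pieces `B ∩ γ⁻¹ F` over a set of representatives of `Γ/±1`, move each piece into `F` by the
  invariance of `dμ`; the moved pieces are disjoint). This gives the POINTWISE bound
  `(π/4) |h(τ)|² (Im τ)² ≤ ∫⁻_{X.fd} |h|² Im² dμ` as extended non-negative reals, with no
  hypothesis at all (`ShimuraCurveData.pi_div_four_mul_le_lintegral_fd`), and Thm. 8.1 with
  `ν = 2/√π` whenever `|h|² Im²` is integrable on `X.fd` (`….hypSupNorm_le_of_integrableOn`).

## The finiteness of `vol(X₀^D(M))` and the discharge

The tree's rendering of `‖h‖₂` is the Bochner integral over the datum's ARBITRARY measurable a.e.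
fundamental domain `X.fd`; when `|h|² Im²` is not integrable on `X.fd` it is the junk value `0`.
Pasten's standing fact "`X_{U,g}^{an}` is a compact … curve, because `B` is a division algebra"
(§8.1 p. 29) — i.e. `Γ₀^D(M)` is a cocompact lattice, in particular `vol(X.fd) < ∞` (Vignéras IV
Thm. 1.1) — is exactly what excludes this case (a bounded `Γ`-invariant function is then
integrable on `X.fd`; an unbounded `|h| Im` has junk `hypSupNorm h = 0`), and it is genuinely
needed: for the abstract data (`Γ = {±1}`, `F = ℍ`, `h = (z + i)⁻¹ ∈ S₂({±1})`) one has
`sup |h| Im = 1` but `∫_ℍ |h|² dx dy = ∞`. That finiteness is the tree's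
`ShimuraCurveData.volume_fd_lt_top` (`ShimuraCurveFiniteVolume.lean`, by Minkowski's theorem on the
lattice `ι(O) ⊂ M₂(ℝ)`); this file proves `PastenShimura2024_thm_8_1_of_volume_fd_ne_top`
(Thm. 8.1 from `∀ X, 1 < D → vol(X.fd) ≠ ∞`), `PastenShimura2024_thm_8_1_of_volume_fd_eq`
(Thm. 8.1 from Shimizu's formula `ShimuraCurveData.volume_fd_eq`; level `M = 0` is vacuous,
`ShimuraCurveData.level_pos`), and finally the unconditional discharge
`PastenShimura2024_thm_8_1_holds`.

## References

* H. Pasten, *Shimura curves and the abc conjecture*, J. Number Theory 254 (2024) 214–335 =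
  arXiv:1705.09251, §8 pp. 29–30 (Thm. 8.1, Lemmas 8.2–8.5). [PastenShimura2024]
* M.-F. Vignéras, *Arithmétique des algèbres de quaternions*, LNM 800 (1980), Ch. IV §1
  (Thm. 1.1: `ι(O¹)` is discrete of finite covolume, cocompact iff `H` is a field). [VignerasLNM800]
-/

noncomputable section

open scoped MatrixGroups ModularForm ENNReal NNReal Pointwise
open _root_.MeasureTheory Set Metric UpperHalfPlane

namespace Literature.NumberTheory.Automorphic

open Literature.NumberTheory.EllipticCurves.ModularForms (lintegral_domain_eq_lintegral_image)

/-! ### Packing a set that injects into `Γ∖ℍ` into a fundamental domain -/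

/-- **Packing lemma.** Let `F` be an a.e. fundamental domain of the countable group `Γ ∋ -1`
(`IsHypFundamentalDomain`; only "every orbit meets `F`" is used), `T ⊆ ℍ` a measurable set no two
points of which are `Γ`-equivalent except by `±1`, and `G ≥ 0` a `Γ`-invariant function. Then
`∫⁻_T G dμ ≤ ∫⁻_F G dμ`: cover `T` by the pieces `T ∩ γ⁻¹F`, `γ` in a set of representatives of
`Γ/{±1}`, and move each piece into `F` (invariance of `dμ`, Mathlib
`SMulInvariantMeasure (GL (Fin 2) ℝ) ℍ volume`); the moved pieces are pairwise disjoint. This is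
the step "`∫_{B_ℍ(τ,r)} |h|² y² dμ ≤ ‖h‖²₂`" of Pasten's proof of Thm. 8.1 (p. 30).
[cite: PastenShimura2024, §8.3 p. 30 (proof of Thm. 8.1)] -/
theorem setLIntegral_le_setLIntegral_fd_of_injective {Γ : Subgroup (GL (Fin 2) ℝ)} {F : Set ℍ}
    (hF : IsHypFundamentalDomain Γ F) (hΓ : (Γ : Set (GL (Fin 2) ℝ)).Countable) (hneg : -1 ∈ Γ)
    {T : Set ℍ} (hT : MeasurableSet T)
    (hinj : ∀ z ∈ T, ∀ γ ∈ Γ, γ • z ∈ T → γ = 1 ∨ γ = -1)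
    {G : ℍ → ℝ≥0∞} (hGinv : ∀ γ ∈ Γ, ∀ z : ℍ, G (γ • z) = G z) :
    ∫⁻ z in T, G z ≤ ∫⁻ z in F, G z := by
  -- the "positive half" of `Γ`, a set of representatives of `Γ / {±1}`
  let P : Set (GL (Fin 2) ℝ) :=
    {γ | γ ∈ Γ ∧ (0 < (γ 1 0 : ℝ) ∨ ((γ 1 0 : ℝ) = 0 ∧ 0 < (γ 1 1 : ℝ)))}
  haveI : Countable P := (hΓ.mono fun γ hγ => hγ.1).to_subtype
  have hPneg : ∀ γ ∈ Γ, γ ∉ P → -γ ∈ P := by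
    intro γ hγ hγP
    refine ⟨by rw [← neg_one_mul]; exact Γ.mul_mem hneg hγ, ?_⟩
    have hdet : (γ 0 0 : ℝ) * γ 1 1 - γ 0 1 * γ 1 0 ≠ 0 := by
      rw [← Matrix.det_fin_two]
      exact Matrix.GeneralLinearGroup.det_ne_zero γ
    simp only [P, mem_setOf_eq, not_and, not_or, not_lt] at hγP
    obtain ⟨h1, h2⟩ := hγP hγ
    rcases h1.lt_or_eq with hlt | heq
    · left
      change 0 < -(γ 1 0 : ℝ)
      linarith
    · right
      have h3 := h2 heq
      have h4 : (γ 1 1 : ℝ) ≠ 0 := by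
        intro h; apply hdet; rw [heq, h]; ring
      refine ⟨?_, ?_⟩
      · change -(γ 1 0 : ℝ) = 0
        rw [heq, neg_zero]
      · change 0 < -(γ 1 1 : ℝ)
        rcases h3.lt_or_eq with h | h
        · linarith
        · exact absurd h h4
  have hPuniq : ∀ γ ∈ P, -γ ∉ P := by
    rintro γ ⟨-, hγ⟩ ⟨-, hγ'⟩
    change 0 < -(γ 1 0 : ℝ) ∨ (-(γ 1 0 : ℝ) = 0 ∧ 0 < -(γ 1 1 : ℝ)) at hγ'
    rcases hγ with h | ⟨h, h'⟩ <;> rcases hγ' with g | ⟨g, g'⟩ <;> linarith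
  -- the pieces
  let A : P → Set ℍ := fun γ => {z | z ∈ T ∧ (γ : GL (Fin 2) ℝ) • z ∈ F}
  have hAmeas : ∀ γ, MeasurableSet (A γ) := fun γ =>
    hT.inter (hF.measurableSet.preimage (measurable_const_smul _))
  have hcover : T ⊆ ⋃ γ, A γ := by
    intro z hz
    obtain ⟨γ, hγ, hγz⟩ := hF.covers z
    by_cases hP : γ ∈ P
    · exact mem_iUnion.mpr ⟨⟨γ, hP⟩, hz, hγz⟩
    · refine mem_iUnion.mpr ⟨⟨-γ, hPneg γ hγ hP⟩, hz, ?_⟩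
      change -γ • z ∈ F
      rwa [UpperHalfPlane.neg_smul]
  -- change of variables on each piece
  have hpiece : ∀ γ : P, ∫⁻ z in A γ, G z = ∫⁻ z in (γ : GL (Fin 2) ℝ) • A γ, G z := by
    intro γ
    have h := (measurePreserving_smul (γ : GL (Fin 2) ℝ)
      (volume : Measure ℍ)).setLIntegral_comp_preimage_emb
      (measurableEmbedding_const_smul (γ : GL (Fin 2) ℝ)) G ((γ : GL (Fin 2) ℝ) • A γ)
    rw [preimage_smul, inv_smul_smul] at h
    rw [← h]
    refine setLIntegral_congr_fun (hAmeas γ) fun z _ => ?_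
    exact (hGinv _ γ.2.1 z).symm
  -- the translated pieces are disjoint and lie in `F`
  have hsub : ∀ γ : P, (γ : GL (Fin 2) ℝ) • A γ ⊆ F := by
    rintro γ _ ⟨z, hz, rfl⟩
    exact hz.2
  have hdisj : Pairwise (Function.onFun Disjoint fun γ : P => (γ : GL (Fin 2) ℝ) • A γ) := by
    intro γ γ' hne
    rw [Function.onFun, Set.disjoint_left]
    rintro _ ⟨z, hz, rfl⟩ ⟨z', hz', heq⟩
    have heq' : (γ' : GL (Fin 2) ℝ) • z' = (γ : GL (Fin 2) ℝ) • z := heq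
    have hmem : ((γ : GL (Fin 2) ℝ)⁻¹ * γ') • z' ∈ T := by
      rw [mul_smul, heq', inv_smul_smul]; exact hz.1
    have hγγ' : ((γ : GL (Fin 2) ℝ)⁻¹ * γ') ∈ Γ := Γ.mul_mem (Γ.inv_mem γ.2.1) γ'.2.1
    rcases hinj z' hz'.1 _ hγγ' hmem with h | h
    · apply hne
      rw [inv_mul_eq_one] at h
      exact Subtype.ext h
    · rw [inv_mul_eq_iff_eq_mul, mul_neg_one] at h
      exact hPuniq _ γ.2 (h ▸ γ'.2)
  calc ∫⁻ z in T, G z ≤ ∫⁻ z in ⋃ γ : P, A γ, G z := lintegral_mono_set hcover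
    _ ≤ ∑' γ : P, ∫⁻ z in A γ, G z := lintegral_iUnion_le _ _
    _ = ∑' γ : P, ∫⁻ z in (γ : GL (Fin 2) ℝ) • A γ, G z := tsum_congr hpiece
    _ = ∫⁻ z in ⋃ γ : P, (γ : GL (Fin 2) ℝ) • A γ, G z :=
        (lintegral_iUnion (fun γ => (hAmeas γ).const_smul _) hdisj _).symm
    _ ≤ ∫⁻ z in F, G z := lintegral_mono_set (iUnion_subset hsub)

/-! ### The sub-mean-value inequality on the disc `B(τ, Im τ / 2) ⊆ ℍ` -/

section Local

variable {Γ : Subgroup (GL (Fin 2) ℝ)} {k : ℤ}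

/-- A cusp form extended to `ℂ` by `ofComplex` is measurable (continuous on the open upper
half-plane, constant below it). [folklore] -/
theorem measurable_cuspForm_comp_ofComplex (f : CuspForm Γ k) : Measurable (⇑f ∘ ofComplex) := by
  have hs : MeasurableSet {z : ℂ | 0 < z.im} :=
    (isOpen_lt continuous_const Complex.continuous_im).measurableSet
  refine measurable_of_restrict_of_restrict_compl hs ?_ ?_
  · have hsrc : ofComplex.source = {z : ℂ | 0 < z.im} := by simp [UpperHalfPlane.ofComplex]
    have hc : ContinuousOn (⇑f ∘ ofComplex) {z : ℂ | 0 < z.im} := by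
      rw [← hsrc]
      exact (CuspFormClass.holo f).continuous.comp_continuousOn ofComplex.continuousOn
    exact (continuousOn_iff_continuous_restrict.mp hc).measurable
  · have : {z : ℂ | 0 < z.im}ᶜ.restrict (⇑f ∘ ofComplex) =
        fun _ => f (Classical.choice inferInstance) := by
      funext w
      have hw : (w : ℂ).im ≤ 0 := not_lt.mp w.2
      simp [ofComplex_apply_of_im_nonpos hw]
    rw [this]
    exact measurable_const

/-- The Euclidean disc `B(τ, Im τ / 2)` lies in the upper half-plane: its points have
`Im z > Im τ / 2`. [folklore] -/
theorem half_im_lt_im_of_dist_lt (τ : ℍ) {w : ℂ} (hw : dist w (τ : ℂ) < τ.im / 2) :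
    τ.im / 2 < w.im := by
  have h1 : |(w - (τ : ℂ)).im| ≤ ‖w - (τ : ℂ)‖ := Complex.abs_im_le_norm _
  rw [Complex.sub_im, UpperHalfPlane.coe_im] at h1
  rw [dist_eq_norm] at hw
  have := (abs_le.mp (h1.trans hw.le)).1
  have hτ := τ.im_pos
  by_contra hle
  push Not at hle
  -- `w.im ≤ τ.im / 2` and `-(τ.im/2) ≤ w.im - τ.im` force `w.im = τ.im / 2`, but the
  -- inequality `hw` is strict
  have h2 : ‖w - (τ : ℂ)‖ < τ.im / 2 := hw
  have h3 : τ.im - w.im ≤ ‖w - (τ : ℂ)‖ := by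
    have := neg_abs_le (w - (τ : ℂ)).im
    rw [Complex.sub_im, UpperHalfPlane.coe_im] at this
    linarith [Complex.abs_im_le_norm (w - (τ : ℂ))]
  linarith

/-- The image in `ℂ` of the hyperbolic-plane disc `{z : dist z τ < Im τ / 2}` is the Euclidean disc
`B(τ, Im τ / 2)`. [folklore] -/
theorem image_coe_setOf_dist_lt (τ : ℍ) :
    ((↑) : ℍ → ℂ) '' {z : ℍ | dist (z : ℂ) (τ : ℂ) < τ.im / 2} = ball (τ : ℂ) (τ.im / 2) := by
  ext w
  constructor
  · rintro ⟨z, hz, rfl⟩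
    exact hz
  · intro hw
    have him : 0 < w.im := lt_trans (half_pos τ.im_pos) (half_im_lt_im_of_dist_lt τ hw)
    exact ⟨⟨w, him⟩, hw, rfl⟩

/-- **Sub-mean-value inequality on the disc `B(τ, Im τ / 2)`** (Pasten Lemmas 8.4–8.5 with a
Euclidean disc): for a weight-`k` cusp form `f` on any `Γ ≤ GL₂(ℝ)` and `τ ∈ ℍ`,
`(π/4) |f(τ)|² (Im τ)² ≤ ∫_{dist(z,τ) < Im τ/2} |f(z)|² (Im z)² dμ(z)` — on `ℍ ⊆ ℂ` the density
`(Im z)² dμ` is Lebesgue measure, and `π r² |f(τ)|² ≤ ∬_{B(τ,r)} |f|² dx dy` for the holomorphic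
`f` (tree `pi_mul_sq_mul_enorm_sq_le_lintegral_ball`), `r = Im τ / 2`.
[cite: PastenShimura2024, §8.3 Lemmas 8.4–8.5 p. 30] -/
theorem pi_div_four_mul_le_setLIntegral_ball (f : CuspForm Γ k) (τ : ℍ) :
    ENNReal.ofReal (Real.pi / 4) * ENNReal.ofReal (‖f τ‖ ^ 2 * τ.im ^ 2) ≤
      ∫⁻ z in {z : ℍ | dist (z : ℂ) (τ : ℂ) < τ.im / 2}, ENNReal.ofReal (‖f z‖ ^ 2 * z.im ^ 2) := by
  have hr : 0 < τ.im / 2 := half_pos τ.im_pos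
  have hT : MeasurableSet {z : ℍ | dist (z : ℂ) (τ : ℂ) < τ.im / 2} :=
    (isOpen_lt (continuous_coe.dist continuous_const) continuous_const).measurableSet
  rw [lintegral_domain_eq_lintegral_image hT f, image_coe_setOf_dist_lt]
  have hdiff : DifferentiableOn ℂ (⇑f ∘ ofComplex) (ball (τ : ℂ) (τ.im / 2)) :=
    (UpperHalfPlane.mdifferentiable_iff.mp (CuspFormClass.holo f)).mono fun w hw =>
      lt_trans hr (half_im_lt_im_of_dist_lt τ hw)
  have key := Literature.Analysis.Complex.pi_mul_sq_mul_enorm_sq_le_lintegral_ball hr hdiff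
    (measurable_cuspForm_comp_ofComplex f)
  have hpt : (⇑f ∘ ofComplex) (τ : ℂ) = f τ := by simp [ofComplex_apply]
  rw [hpt] at key
  have hsq : ∀ x : ℂ, (‖x‖ₑ : ℝ≥0∞) ^ 2 = ENNReal.ofReal (‖x‖ ^ 2) := fun x => by
    rw [← ofReal_norm, ENNReal.ofReal_pow (norm_nonneg _)]
  simp only [Function.comp_apply, hsq] at key
  calc ENNReal.ofReal (Real.pi / 4) * ENNReal.ofReal (‖f τ‖ ^ 2 * τ.im ^ 2)
      = ENNReal.ofReal (Real.pi * (τ.im / 2) ^ 2) * ENNReal.ofReal (‖f τ‖ ^ 2) := by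
        rw [← ENNReal.ofReal_mul (by positivity), ← ENNReal.ofReal_mul (by positivity)]
        congr 1
        ring
    _ ≤ _ := key

end Local

/-! ### The pointwise bound on `X₀^D(M)` and Thm. 8.1 -/

namespace ShimuraCurveData

variable {D M : ℕ} (X : ShimuraCurveData D M)

/-- `|h(γ z)|² (Im γz)² = |h(z)|² (Im z)²` for `γ ∈ Γ₀^D(M)` and `h` of weight `2`
(`h(γz) = (cz + d)² h(z)`, `Im γz = Im z / |cz + d|²`). [folklore] -/
theorem norm_sq_mul_im_sq_smul (h : CuspForm X.Gamma 2) {γ : GL (Fin 2) ℝ} (hγ : γ ∈ X.Gamma)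
    (z : ℍ) : ‖h (γ • z)‖ ^ 2 * (γ • z).im ^ 2 = ‖h z‖ ^ 2 * z.im ^ 2 := by
  rw [SlashInvariantForm.slash_action_eqn'' h hγ z, im_smul_eq_div_normSq]
  have hdet : |((Matrix.GeneralLinearGroup.det γ : ℝˣ) : ℝ)| = 1 := by
    rw [hγ.2.2, Units.val_one, abs_one]
  rw [hdet, one_mul, norm_mul, norm_zpow, Complex.normSq_eq_norm_sq]
  have hD : ‖denom γ z‖ ≠ 0 := norm_ne_zero_iff.mpr (denom_ne_zero γ z)
  field_simp

/-- **The pointwise bound** (the heart of Pasten's proof of Thm. 8.1, pp. 29–30, over `ℚ`): for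
`D > 1`, `Γ₀^D(M)` acting without fixed points except for `±1`, every `h ∈ S₂(Γ₀^D(M))` and every
`τ ∈ ℍ`: `(π/4) |h(τ)|² (Im τ)² ≤ ∫⁻_{X.fd} |h|² (Im z)² dμ` (extended non-negative reals; no
integrability or volume hypothesis). The disc `B(τ, Im τ/2)` has hyperbolic diameter
`< arccosh 3`, so by `seven_le_two_mul_cosh_dist_smul` it injects into `Γ∖ℍ`, and the packing
lemma applies to the sub-mean-value inequality. [cite: PastenShimura2024, Thm. 8.1 p. 29 and its proof §8.3 p. 30] -/
theorem pi_div_four_mul_le_lintegral_fd (hD : 1 < D)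
    (hfree : ∀ γ ∈ X.Gamma, (∃ z : ℍ, γ • z = z) → γ = 1 ∨ γ = -1)
    (h : CuspForm X.Gamma 2) (τ : ℍ) :
    ENNReal.ofReal (Real.pi / 4) * ENNReal.ofReal (‖h τ‖ ^ 2 * τ.im ^ 2) ≤
      ∫⁻ z in X.fd, ENNReal.ofReal (‖h z‖ ^ 2 * z.im ^ 2) := by
  refine (pi_div_four_mul_le_setLIntegral_ball h τ).trans ?_
  have hT : MeasurableSet {z : ℍ | dist (z : ℂ) (τ : ℂ) < τ.im / 2} :=
    (isOpen_lt (continuous_coe.dist continuous_const) continuous_const).measurableSet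
  refine setLIntegral_le_setLIntegral_fd_of_injective X.isHypFundamentalDomain_fd X.countable_Gamma
    X.neg_one_mem_Gamma hT ?_ (fun γ hγ z => by rw [X.norm_sq_mul_im_sq_smul h hγ z])
  -- two points of the disc are at hyperbolic distance `< arccosh 3`
  intro z hz γ hγ hγz
  by_contra hne
  push Not at hne
  have h7 := X.seven_le_two_mul_cosh_dist_smul hD hfree hγ hne.1 hne.2 z
  have hzi : τ.im / 2 < z.im := half_im_lt_im_of_dist_lt τ hz
  have hγzi : τ.im / 2 < (γ • z).im := half_im_lt_im_of_dist_lt τ hγz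
  have hdist : dist (z : ℂ) ((γ • z : ℍ) : ℂ) < τ.im := by
    have := dist_triangle (z : ℂ) (τ : ℂ) ((γ • z : ℍ) : ℂ)
    rw [dist_comm (τ : ℂ)] at this
    have hz' : dist (z : ℂ) (τ : ℂ) < τ.im / 2 := hz
    have hγz' : dist ((γ • z : ℍ) : ℂ) (τ : ℂ) < τ.im / 2 := hγz
    linarith
  have hτ := τ.im_pos
  have hcosh : Real.cosh (dist z (γ • z)) < 3 := by
    rw [UpperHalfPlane.cosh_dist]
    have hden : 0 < 2 * z.im * (γ • z).im := by positivity
    have hnum : dist (z : ℂ) ((γ • z : ℍ) : ℂ) ^ 2 < τ.im ^ 2 :=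
      pow_lt_pow_left₀ hdist dist_nonneg two_ne_zero
    have hden' : τ.im ^ 2 / 2 < 2 * z.im * (γ • z).im := by nlinarith
    have : dist (z : ℂ) ((γ • z : ℍ) : ℂ) ^ 2 / (2 * z.im * (γ • z).im) < 2 := by
      rw [div_lt_iff₀ hden]
      nlinarith
    linarith
  linarith

/-- **Thm. 8.1 pointwise, for square-integrable `h`**: if `|h|² Im²` is integrable on `X.fd` then
`|h(τ)| Im τ ≤ (2/√π) ‖h‖_{U₀^D(M),2}` for every `τ` (`X.norm`, the tree's un-normalised
Petersson norm). [cite: PastenShimura2024, Thm. 8.1 p. 29] -/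
theorem norm_mul_im_le_of_integrableOn (hD : 1 < D)
    (hfree : ∀ γ ∈ X.Gamma, (∃ z : ℍ, γ • z = z) → γ = 1 ∨ γ = -1)
    (h : CuspForm X.Gamma 2) (hint : IntegrableOn (fun z : ℍ => ‖h z‖ ^ 2 * z.im ^ 2) X.fd)
    (τ : ℍ) : ‖h τ‖ * τ.im ≤ 2 / Real.sqrt Real.pi * X.norm h := by
  have hpt := X.pi_div_four_mul_le_lintegral_fd hD hfree h τ
  have heq : ∫⁻ z in X.fd, ENNReal.ofReal (‖h z‖ ^ 2 * z.im ^ 2) =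
      ENNReal.ofReal (X.normSq h) := by
    rw [ShimuraCurveData.normSq, peterssonNormSq,
      ofReal_integral_eq_lintegral_ofReal hint (ae_of_all _ fun z => by positivity)]
  have hnn : 0 ≤ X.normSq h := peterssonNormSq_nonneg _ _
  rw [heq, ← ENNReal.ofReal_mul (by positivity), ENNReal.ofReal_le_ofReal_iff hnn] at hpt
  have hπ : 0 < Real.pi := Real.pi_pos
  have hsqπ : 0 < Real.sqrt Real.pi := Real.sqrt_pos.mpr hπ
  -- `(‖h τ‖ Im τ)² ≤ (4/π) normSq`, take square roots
  have h1 : (‖h τ‖ * τ.im) ^ 2 ≤ (2 / Real.sqrt Real.pi * X.norm h) ^ 2 := by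
    rw [mul_pow, mul_pow, div_pow, Real.sq_sqrt hπ.le, ShimuraCurveData.norm,
      Real.sq_sqrt hnn, div_mul_eq_mul_div, le_div_iff₀ hπ]
    linarith
  have h2 : 0 ≤ 2 / Real.sqrt Real.pi * X.norm h := by
    have : 0 ≤ X.norm h := Real.sqrt_nonneg _
    positivity
  have h0 : 0 ≤ ‖h τ‖ * τ.im := mul_nonneg (norm_nonneg _) τ.im_pos.le
  exact (pow_le_pow_iff_left₀ h0 h2 two_ne_zero).mp h1

/-- **Thm. 8.1 for square-integrable `h`**: `‖h‖_{U,∞} ≤ (2/√π) ‖h‖_{U,2}` (`hypSupNorm`, `X.norm`)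
whenever `|h|² Im²` is integrable on `X.fd`. [cite: PastenShimura2024, Thm. 8.1 p. 29] -/
theorem hypSupNorm_le_of_integrableOn (hD : 1 < D)
    (hfree : ∀ γ ∈ X.Gamma, (∃ z : ℍ, γ • z = z) → γ = 1 ∨ γ = -1)
    (h : CuspForm X.Gamma 2) (hint : IntegrableOn (fun z : ℍ => ‖h z‖ ^ 2 * z.im ^ 2) X.fd) :
    hypSupNorm h ≤ 2 / Real.sqrt Real.pi * X.norm h :=
  ciSup_le fun τ => X.norm_mul_im_le_of_integrableOn hD hfree h hint τ

/-- **Thm. 8.1 for a datum of finite volume**: if `vol(X.fd) < ∞` then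
`‖h‖_{U,∞} ≤ (2/√π) ‖h‖_{U,2}` for every `h ∈ S₂(Γ₀^D(M))` (either `|h| Im` is unbounded, and the
left side is the junk value `0`, or it is bounded and `|h|² Im²` is integrable on `X.fd`).
[cite: PastenShimura2024, Thm. 8.1 p. 29] -/
theorem hypSupNorm_le_of_volume_fd_ne_top (hD : 1 < D)
    (hfree : ∀ γ ∈ X.Gamma, (∃ z : ℍ, γ • z = z) → γ = 1 ∨ γ = -1)
    (hvol : volume X.fd ≠ ⊤) (h : CuspForm X.Gamma 2) :
    hypSupNorm h ≤ 2 / Real.sqrt Real.pi * X.norm h := by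
  by_cases hbdd : BddAbove (Set.range fun z : ℍ => ‖h z‖ * z.im)
  · refine X.hypSupNorm_le_of_integrableOn hD hfree h ?_
    obtain ⟨C, hC⟩ := hbdd
    have hcont : Continuous fun z : ℍ => ‖h z‖ ^ 2 * z.im ^ 2 :=
      ((CuspFormClass.holo h).continuous.norm.pow 2).mul (continuous_im.pow 2)
    refine Measure.integrableOn_of_bounded (M := C ^ 2) hvol hcont.aestronglyMeasurable ?_
    refine ae_of_all _ fun z => ?_
    have hz : ‖h z‖ * z.im ≤ C := hC ⟨z, rfl⟩
    have h0 : 0 ≤ ‖h z‖ * z.im := mul_nonneg (norm_nonneg _) z.im_pos.le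
    rw [Real.norm_eq_abs, abs_of_nonneg (by positivity), ← mul_pow]
    exact pow_le_pow_left₀ h0 hz 2
  · rw [hypSupNorm, Real.iSup_of_not_bddAbove hbdd]
    have : 0 ≤ X.norm h := Real.sqrt_nonneg _
    positivity

/-- A Shimura curve datum has positive level: an Eichler order `O = O₁ ∩ O₂` has finite index in
`O₁` (both are full `ℤ`-lattices), so `[O₁ : O] = M ≠ 0`. [folklore] -/
theorem level_pos (X : ShimuraCurveData D M) : 0 < M := by
  obtain ⟨O₁, O₂, hO₁, -, -, hidx⟩ := X.isEichlerOrder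
  rw [Nat.pos_iff_ne_zero, ← hidx]
  haveI : IsAddTorsionFree X.B := isAddTorsionFree_of_charZero_module ℚ X.B
  exact relIndex_ne_zero_of_isFullLattice X.isOrder.isFullLattice hO₁.1.isFullLattice.1

end ShimuraCurveData

/-- **Pasten 2024, Thm. 8.1 over `ℚ`, from the finiteness of `vol(X₀^D(M))`**: if every Shimura
curve datum with `D > 1` has a fundamental domain of finite hyperbolic area (Vignéras IV
Thm. 1.1: `Γ₀^D(M)` is a cocompact lattice when `B` is a division algebra), then the named fact
`PastenShimura2024_thm_8_1` holds, with `ν = 2/√π`. [cite: PastenShimura2024, Thm. 8.1 p. 29] -/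
theorem PastenShimura2024_thm_8_1_of_volume_fd_ne_top
    (hvol : ∀ {D M : ℕ} (X : ShimuraCurveData D M), 1 < D → volume X.fd ≠ ⊤) :
    PastenShimura2024_thm_8_1 := by
  refine ⟨2 / Real.sqrt Real.pi, by positivity, ?_⟩
  intro D M X hD hfree h
  exact X.hypSupNorm_le_of_volume_fd_ne_top hD hfree (hvol X hD) h

/-- **Pasten 2024, Thm. 8.1 over `ℚ`, from Shimizu's volume formula**: the named fact
`ShimuraCurveData.volume_fd_eq` (`vol(X.fd) = (π/3) φ(D) ψ(M) < ∞` for `M > 0`; and `M > 0`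
always, `ShimuraCurveData.level_pos`) implies `PastenShimura2024_thm_8_1`.
[cite: PastenShimura2024, Thm. 8.1 p. 29] -/
theorem PastenShimura2024_thm_8_1_of_volume_fd_eq (H : ShimuraCurveData.volume_fd_eq) :
    PastenShimura2024_thm_8_1 :=
  PastenShimura2024_thm_8_1_of_volume_fd_ne_top fun X _ => by
    rw [H X X.level_pos]
    exact ENNReal.ofReal_ne_top

/-- **Pasten 2024, Thm. 8.1 over `ℚ` (norm comparison), unconditionally.** Let `D > 1` and let
`X = X₀^D(M)` be a Shimura curve datum whose group `Γ₀^D(M)` acts on `ℍ` without fixed points (up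
to `±1`). Then there is an absolute `ν > 0` (here `ν = 2/√π`) with `‖h‖_∞ ≤ ν ‖h‖₂` for every weight-2
cusp form `h` on `Γ₀^D(M)`, where `‖h‖_∞ = sup_z |h(z)| Im z` and `‖h‖₂² = ∫_{X.fd} |h|² y² dμ_hyp`.
Printed proof (Pasten §8, pp. 29–30): integral traces in `ι(O¹)` give a uniform injectivity
radius (`ShimuraCurveUnitGroupTraces.lean`), and the sub-mean-value property on an injected ball
bounds `|h(τ)|² Im(τ)²` by `(4/π) ‖h‖₂²` (this file); the finiteness of `vol(X.fd)` for `D > 1`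
("`X` is compact because `B` is a division algebra", Pasten §8.1; Vignéras IV Thm. 1.1), needed to
make the tree's Bochner `L²`-norm honest, is `ShimuraCurveData.volume_fd_lt_top`
(`ShimuraCurveFiniteVolume.lean`). [cite: PastenShimura2024, Thm. 8.1 p. 29 (arXiv:1705.09251 §8)] -/
theorem PastenShimura2024_thm_8_1_holds : PastenShimura2024_thm_8_1 :=
  PastenShimura2024_thm_8_1_of_volume_fd_ne_top fun X hD => (X.volume_fd_lt_top hD).ne

end Literature.NumberTheory.Automorphic

end
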